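import Summits.BirchSwinnertonDyer.BirchSwinnertonDyer.Theorems.EisensteinPrimesBSDpOnCellCTwistPartnerPointwise
import Summits.BirchSwinnertonDyer.BirchSwinnertonDyer.Theorems.EisensteinPrimesBSDpOnCellCNotGVDoors
import Summits.BirchSwinnertonDyer.Rank1Residual.X2.CellCBDPValueLZZRoadInputOfFact
import Summits.BirchSwinnertonDyer.Rank1Residual.X2.IMCEqOnTreeIntOther
import Literature.NumberTheory.EllipticCurves.Wuthrich2014.ShaBoundProofs
import Literature.NumberTheory.EllipticCurves.IsogenyQuadraticTwistProofs
import Literature.NumberTheory.EllipticCurves.IsogenyConductorModularityProofs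
import Literature.NumberTheory.EllipticCurves.ComplexMultiplicationLFunctionIsogenyHoldsProofs
import HarnessLib

/-!
# Crux 4 `BSDpOnCellC` (stmt-BirchSwinnertonDyer-19034), line b1 v9: the per-pair TWIST-CERTIFICATE road —
# `BSD(E,p)` at an X2c pair of EITHER ψ-parity from the b1 atoms (value + re-oriented IMC) and ONE admissible
# Heegner field `K` whose rank-zero twist `E^{(d_K)}` has its `p`-part CLOSED, in particular by Wuthrich 2014
# Prop. 21 when `p ∤ #Ш(E^{(d_K)})_an` — NO crux 3, NO Greenberg–Vatsal parity hypothesis on `E`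
# (cell `bsd-eis`, seat `bsd-eis-cgshw` g15; part 2 of 2, part 1 = `…TwistPartnerPointwise.lean`)

HONEST FRAMING (cell `bsd-eis`, run/shared/lean/pub/bsd-eis/): theorems only; nothing booked; X2 stays
CONSTRUCTION-SHAPED; no label or count moves; BSD is not proved by any of this. Every theorem is CONDITIONAL on
its displayed binders: published named facts (incl. Wuthrich 2014 Prop. 21 `sha_dvd_analyticSha`, Cassels'
isogeny invariance, Mazur on the Manin constant), the value atom (§3: from the typed input `X2.LZZRoadInputIoo`,
itself implied by the REFEREED Liu–Zhang–Zhang fact — k5-c4's glue, RULING L56 (2)), the re-oriented IMC atom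
(§3: Keller–Yin 2024 Thm. D BY NAME — UNREFEREED PREPRINT, printed proof gapped at L1754), and PER PAIR an
admissible field `K` + a closed partner (a numeric certificate `p ∤ #Ш(E^{(d_K)})_an` in §2–§3).

## Why (the census lever)

The class-wide b1 composition takes the CGLS partner's rank-zero `p`-part from crux 3 (`MazurMCOnCellB`) on the
ψ-ODD sub-rows `CellCNonsplitGV` / `CellCSplitGV` (the twist of a ψ-odd X2c curve is an X2b curve with `¬GVPar`;
O9 atlas: 1 522 + 1 625 cells @3, 73 + 133 @5, 4 + 16 @7), because it CHOOSES `K` inside the proof. Per pair ONE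
admissible `K` with a closed partner is enough (§1, on the `K`-supplied roads of part 1), and the partner — rank
`0`, `E[p]` reducible, `p` multiplicative — is closed by `bsdp_of_L_one_ne_zero_of_padicValRat_shaAn_eq_zero`
(Wuthrich Prop. 21 + GZK) as soon as `p ∤ #Ш(E^{(d_K)})_an` (§2): the certificate currency of the A3/A10
bookings. k5-c4 g6's census (`HOME/k5-c4-g6/census_merged.tsv`, ≤ 3 admissible `d_K` per pair, |d_K| ≤ 1000,
ONE engine) already exhibits such a `K` for 2 958 of the 3 373 ψ-odd cells (1 301 + 1 450 @3, 62 + 125 @5,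
4 + 16 @7) — memo cgshw MEMO-19; the planner decides any booking and its legs.

* §1 `bsdp_of_cellC_of_twistPartnerBSDp` — `K` supplied, partner = `BSDp` of ANY globally minimal model of
  `E^{(d_K)}`; the Manin condition is moved to the optimal curve `E₀` of the class (`X2.bsdp_of_cellC_of_forall_isIsogenous`),
  `K` stays admissible for `E₀` (`N_{E₀} = N_E`, Atkin–Lehner; `L(E₀^{(d)},1) = L(E^{(d)},1)`, twisting commutes
  with isogenies — Cremona §3.9 — and isogenous curves share `L`), and the partner travels `E^{(d)} ∼ E₀^{(d)}` by
  Cassels (`X2.bsdp_of_isIsogenous_of_bsdp`); then part 1 by sign.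
* §2 `bsdp_of_cellC_of_twistShaUnit` — the same with the partner DISCHARGED from `p ∤ #Ш(E^{(d_K)})_an`.
* §3 `bsdp_of_cellC_of_twistShaUnit_of_lzzRoadInputIoo_of_thmD_OPEN` — the census shape: v9's published bundle
  + Wuthrich Prop. 21 + `X2.LZZRoadInputIoo` + Keller–Yin Thm. D + (pair, `K`, certificate) ⊢ `BSDp W p`; and
  `…_of_thm151_thm153_of_thmD_OPEN` — the same with the REFEREED Liu–Zhang–Zhang fact in place of the typed input
  (k5-c4's glue `X2.lzzRoadInputIoo_of_thm151_thm153`, p515022).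
* §4 `bsdp_of_cellC_of_isogenousTwistShaUnit` — §2 with the certificate read on any curve `ℚ`-isogenous to the twist.

What this is NOT: not a class-wide theorem on the ψ-odd rows (crux 3 stays their class-wide input); not a
count move; the certificate is ONE-ENGINE numerics on file (k5-c4 g6) until the planner legs it.

References: [CastellaEtAl2021] Thm. 5.3.1 and (5.5)–(5.7); [Wuthrich2014] Prop. 21 (p. 400); [Mazur1978] Cor. 4.1;
[AtkinLehner1970] Thm. 4; [CremonaAlgorithms1997] §3.9; [MilneADT2006] Thm. I.7.3 (Cassels); [Hsieh2014] Thm. 1;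
[KellerYin2024] Thm. D = Thm. 5.1.3 (PRE); [LiuZhangZhang2018] Duke 167 Thm. 1.5.1/1.5.3; [Miller2011LMS] Def. 1.1;
RULINGS L31 / L34 / L56 / L57; cgshw MEMO-19.
-/

set_option autoImplicit false
set_option linter.dupNamespace false

noncomputable section

open scoped Classical MatrixGroups ModularForm Topology

open Filter CongruenceSubgroup WeierstrassCurve NumberField IsDedekindDomain Field PowerSeries
  Literature.NumberTheory.EllipticCurves Literature.NumberTheory.EllipticCurves.GreenbergSelmer
  Literature.NumberTheory.EllipticCurves.ModularForms Literature.NumberTheory.QuadraticFields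
  Literature.NumberTheory.EllipticCurves.Rank1Residual
  Literature.NumberTheory.EllipticCurves.Rank1Residual.Typed
  Literature.NumberTheory.EllipticCurves.KrizLi2019
  Literature.NumberTheory.EllipticCurves.GreenbergVatsal2000
  Literature.NumberTheory.EllipticCurves.Wuthrich2014
  Literature.NumberTheory.EllipticCurves.SteinWuthrich2013
  Literature.NumberTheory.EllipticCurves.Castella2018
  Literature.NumberTheory.EllipticCurves.Castella2018Exceptional
  Literature.NumberTheory.GaloisRepresentations Literature.NumberTheory.GaloisCohomology
  Literature.NumberTheory.Automorphic
  Summit.BirchSwinnertonDyer.Rank1Residual.X11b.AcSelmer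
  Summit.BirchSwinnertonDyer.Rank1Residual.X11b.Halves
  Summit.BirchSwinnertonDyer.Rank1Residual.X11b
  Summit.BirchSwinnertonDyer.Rank1Residual.X2
  Summit.BirchSwinnertonDyer.Rank1Residual

namespace Summit.BirchSwinnertonDyer.BirchSwinnertonDyer.Theorems.Reoriented

/-! ### §1 The door: `K` supplied, partner = `BSD_p` of a model of the twist -/

section Door

variable (W : WeierstrassCurve ℚ) [W.IsElliptic] [W.IsGloballyMinimal] (p : ℕ) [Fact p.Prime]

/-- **TWIST-PARTNER DOOR (either sign at `p`, either ψ-parity): `BSD(E,p)` at an X2c pair from the b1 atoms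
and ONE admissible `K` with `BSD_p` of its rank-zero twist.** Hypotheses: published named facts (`hnf` newform
existence, Poitou–Tate ×2, Hsieh 2014 Thm. 1, Gross–Zagier, Kolyvagin, GZK, Mazur on the Manin constant, Cassels);
the sign-free value atom `h2` for every curve of the class in CellC (c2-cont, `X2.BDPValueContinuousDisplayAt`) and
the re-oriented IMC atoms `h3n` / `h3s` (v9 `stub_c3` shape); `hc : CellC W p`; an ADMISSIBLE `K` for `W`
(imaginary quadratic, `d_K` odd and `< −4`, Heegner for `N_E` and for `p`, `L(E^{(d_K)},1) ≠ 0`); a globally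
minimal model `Wd` of `E^{(d_K)}` with `BSDp Wd p`. Conclusion `BSDp W p`. Proof: Manin to the optimal curve `E₀`
(`X2.bsdp_of_cellC_of_forall_isIsogenous`); `N_{E₀} = N_E` (`conductorNorm_eq_of_isIsogenous_of_modularity_of_isGloballyMinimal`),
`E^{(d)} ∼ E₀^{(d)}` (`IsIsogenous.quadraticTwist`) so `L(E₀^{(d)},1) ≠ 0` and `BSDp` of every model of `E₀^{(d)}`
(`X2.bsdp_of_isIsogenous_of_bsdp`), hence its `PPartRankZero`; then part 1's `K`-supplied road of the sign.
CONDITIONAL on every listed binder; nothing booked. [cite: CastellaEtAl2021, Thm. 5.3.1 and (5.5)–(5.7)]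
[cite: Mazur1978, Cor. 4.1] [cite: AtkinLehner1970, Thm. 4] [cite: CremonaAlgorithms1997, §3.9 (p. 87)]
[cite: MilneADT2006, Thm. I.7.3] [cite: Hsieh2014, Thm. 1 (arXiv:1112.1580 pp. 3–4)]
[claim: KellerYin2024, status: under-review] [cite: Miller2011LMS, Def. 1.1] -/
theorem bsdp_of_cellC_of_twistPartnerBSDp
    (hnf : exists_isNewformOf)
    (hPT : ∀ (K : Type) [Field K] [NumberField K], poitouTate_selmerStructure_duality K)
    (hPT2 : ∀ (K : Type) [Field K] [NumberField K], poitouTate_sha_tateDual K)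
    (hH : hsieh2014_exists_anticyclotomicPAdicLFunction)
    (hGZ : ∀ (N : ℕ) [NeZero N] (W : WeierstrassCurve ℚ) (K : Type) [Field K] [NumberField K],
      gross_zagier N W K)
    (hKo : ∀ (N : ℕ) [NeZero N] (W : WeierstrassCurve ℚ) (K : Type) [Field K] [NumberField K],
      kolyvagin N W K)
    (hGZK : rank_eq_analyticRank_of_analyticRank_le_one)
    (hMaz : mazur_not_dvd_maninConstant_of_odd) (hCassels : bsdRHS_eq_of_isIsogenous)
    (h2 : ∀ (W' : WeierstrassCurve ℚ) [W'.IsElliptic] [W'.IsGloballyMinimal],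
      CellC W' p → BDPValueContinuousDisplayAt W' p)
    (h3n : ∀ (W' : WeierstrassCurve ℚ) [W'.IsElliptic] [W'.IsGloballyMinimal],
      CellC W' p → ¬ W'.HasSplitMultiplicativeReductionAtPrime p → NonsplitIMCEqOnTreeIntOther W' p)
    (h3s : ∀ (W' : WeierstrassCurve ℚ) [W'.IsElliptic] [W'.IsGloballyMinimal],
      CellC W' p → W'.HasSplitMultiplicativeReductionAtPrime p → SplitIMCEqOnTreeIntOther W' p)
    (hc : CellC W p)
    (K : Type) [Field K] [NumberField K] (hK : IsImaginaryQuadratic K)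
    (hodd : Odd (NumberField.discr K)) (hlt : NumberField.discr K < -4)
    (hHN : SatisfiesHeegnerHypothesis (W.conductorNorm ℤ) K) (hHp : SatisfiesHeegnerHypothesis p K)
    (hLK : (W.quadraticTwist (NumberField.discr K : ℚ)).entireLFunction 1 ≠ 0)
    (Wd : WeierstrassCurve ℚ) [Wd.IsElliptic] [Wd.IsGloballyMinimal]
    (hWd : ∃ C : VariableChange ℚ, C • Wd = W.quadraticTwist (NumberField.discr K : ℚ))
    (hbsd : BSDp Wd p) : BSDp W p := by
  have hmod : hasEntireLFunction_rat := WeierstrassCurve.hasEntireLFunction_rat_of_exists_isNewformOf hnf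
  have hpar : nonempty_modularParametrizationData :=
    nonempty_modularParametrizationData_iff_exists_isNewformOf_unconditional.mpr hnf
  -- the PROVED published inputs, by name
  have hEP : ∀ (K : Type) [Field K] [NumberField K] (v : HeightOneSpectrum (𝓞 K)),
      localEulerPoincareCharacteristic (v.adicCompletion K) :=
    fun K _ _ v ↦ X11b.LocBridge.localEulerPoincareCharacteristic_adicCompletionEP K v
  have hcd : fieldCdLE_two_of_numberField :=
    Literature.NumberTheory.GaloisRepresentations.fieldCdLE_two_of_numberField_holds
  have hBr : ∀ (K : Type) [Field K] [NumberField K] (p : ℕ) [Fact p.Prime],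
      ZpExtension.decomp_not_le_kerSubgroup_of_isAnticyclotomic K p :=
    fun K _ _ p _ ↦ ZpExtension.decomp_not_le_kerSubgroup_of_isAnticyclotomic_holds (K := K) (p := p)
  have hHP : ∀ (N : ℕ) [NeZero N] (W : WeierstrassCurve ℚ) (K : Type) [Field K] [NumberField K],
      heegnerPointComplex_mem_range_map N W K :=
    fun N _ W K _ _ ↦ heegnerPointComplex_mem_range_map_holds N W K
  have hEd : edixhoven_optimalManinConstant_integral :=
    ModularForms.edixhoven_optimalManinConstant_integral_holds
  -- the twist of `W`: elliptic, of analytic rank `0`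
  have hD0 : (NumberField.discr K : ℚ) ≠ 0 := by exact_mod_cast NumberField.discr_ne_zero K
  haveI hEt : (W.quadraticTwist (NumberField.discr K : ℚ)).IsElliptic := W.isElliptic_quadraticTwist hD0
  obtain ⟨Cd, hCd⟩ := hWd
  have hLd : Wd.entireLFunction 1 ≠ 0 := by
    rw [← entireLFunction_smul Wd Cd, hCd]; exact hLK
  have hrd : Wd.analyticRank = 0 := (Wd.analyticRank_eq_zero_iff_holds (hmod _)).2 hLd
  have hisoWd : IsIsogenous Wd (W.quadraticTwist (NumberField.discr K : ℚ)) := by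
    rw [← hCd]; exact isIsogenous_smul Wd Cd
  -- Manin to the optimal curve of the class
  refine bsdp_of_cellC_of_forall_isIsogenous hEd hMaz hCassels hpar hnf hGZK W p hc ?_
  intro W₀ _ _ hiso hc₀ hMan₀
  -- `K` is admissible for `W₀`
  have hN : W.conductorNorm ℤ = W₀.conductorNorm ℤ :=
    conductorNorm_eq_of_isIsogenous_of_modularity_of_isGloballyMinimal hpar hiso
  have hHN₀ : SatisfiesHeegnerHypothesis (W₀.conductorNorm ℤ) K := hN ▸ hHN
  haveI hEt₀ : (W₀.quadraticTwist (NumberField.discr K : ℚ)).IsElliptic :=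
    W₀.isElliptic_quadraticTwist hD0
  have hisoT : IsIsogenous (W.quadraticTwist (NumberField.discr K : ℚ))
      (W₀.quadraticTwist (NumberField.discr K : ℚ)) := hiso.quadraticTwist hD0
  have hLK₀ : (W₀.quadraticTwist (NumberField.discr K : ℚ)).entireLFunction 1 ≠ 0 := by
    rw [← entireLFunction_eq_of_isIsogenous' hisoT]; exact hLK
  -- the partner for every model of `W₀^{(d_K)}`, from `BSDp Wd p` along `Wd ∼ W^{(d)} ∼ W₀^{(d)} ∼ Wd₀`
  have htwist : ∀ (Wd₀ : WeierstrassCurve ℚ) [Wd₀.IsElliptic] [Wd₀.IsGloballyMinimal],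
      (∃ C : VariableChange ℚ, C • Wd₀ = W₀.quadraticTwist (NumberField.discr K : ℚ)) →
      Wd₀.analyticRank = 0 → PPartRankZero Wd₀ p := by
    intro Wd₀ _ _ hWd₀ hrd₀
    obtain ⟨C₀, hC₀⟩ := hWd₀
    have hiso₀ : IsIsogenous (W₀.quadraticTwist (NumberField.discr K : ℚ)) Wd₀ := by
      rw [← hC₀]; exact isIsogenous_of_smul Wd₀ C₀
    have hisod : IsIsogenous Wd Wd₀ := (hisoWd.trans' hisoT).trans' hiso₀
    have hbsd₀ : BSDp Wd₀ p :=
      bsdp_of_isIsogenous_of_bsdp hCassels hGZK hmod Wd Wd₀ hisod p (by rw [hrd]; exact zero_le_one) hbsd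
    exact pPartRankZero_of_pPart hGZK Wd₀ p hrd₀ (pPart_of_bsdp hmod hGZK Wd₀ p (by omega) hbsd₀)
  -- part 1 by sign
  by_cases hs : W₀.HasSplitMultiplicativeReductionAtPrime p
  · exact bsdp_of_cellC_of_split_of_manin_of_intResidualsOther_of_twistPartner W₀ p hnf hPT hPT2 hEP hBr
      hH hGZ hKo hHP hGZK hc₀ hs hMan₀ (splitBDPValueOnTreeInt_of_signFree (h2 W₀ hc₀)) (h3s W₀ hc₀ hs)
      K hK hodd hlt hHN₀ hHp hLK₀ htwist
  · exact bsdp_of_cellC_of_not_split_of_manin_of_intResidualsOther_of_twistPartner W₀ p hnf hPT hPT2 hEP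
      hcd hBr hH hGZ hKo hHP hGZK hc₀ hs hMan₀ (nonsplitBDPValueOnTreeInt_of_signFree (h2 W₀ hc₀))
      (h3n W₀ hc₀ hs) K hK hodd hlt hHN₀ hHp hLK₀ htwist

/-! ### §2 The partner discharged by Wuthrich 2014 Prop. 21: `p ∤ #Ш(E^{(d_K)})_an` -/

/-- **TWIST-CERTIFICATE DOOR: as §1 with the partner CLOSED by the numeric certificate `p ∤ #Ш(E^{(d_K)})_an`**
(`hunit`, read on the globally minimal model `Wd` of the twist): `Wd` is X2 at `p` (`X2.classX2_twist`: `E[p]`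
reducible, `p` multiplicative, as `p` splits in `K`), `L(Wd,1) ≠ 0`, so Wuthrich 2014 Prop. 21 + GZK give
`BSDp Wd p` (`bsdp_of_L_one_ne_zero_of_padicValRat_shaAn_eq_zero`, `hW21`). The per-pair certificate currency of
the A3/A10 bookings (T-WU14…), here for the rank-zero TWIST of a rank-one X2c pair of either ψ-parity.
CONDITIONAL on every listed binder; nothing booked. [cite: Wuthrich2014, Prop. 21 (p. 400)]
[cite: CastellaEtAl2021, Thm. 5.3.1 and (5.5)–(5.7)] [cite: Hsieh2014, Thm. 1 (arXiv:1112.1580 pp. 3–4)]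
[claim: KellerYin2024, status: under-review] [cite: Miller2011LMS, Def. 1.1] -/
theorem bsdp_of_cellC_of_twistShaUnit (hW21 : sha_dvd_analyticSha)
    (hnf : exists_isNewformOf)
    (hPT : ∀ (K : Type) [Field K] [NumberField K], poitouTate_selmerStructure_duality K)
    (hPT2 : ∀ (K : Type) [Field K] [NumberField K], poitouTate_sha_tateDual K)
    (hH : hsieh2014_exists_anticyclotomicPAdicLFunction)
    (hGZ : ∀ (N : ℕ) [NeZero N] (W : WeierstrassCurve ℚ) (K : Type) [Field K] [NumberField K],
      gross_zagier N W K)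
    (hKo : ∀ (N : ℕ) [NeZero N] (W : WeierstrassCurve ℚ) (K : Type) [Field K] [NumberField K],
      kolyvagin N W K)
    (hGZK : rank_eq_analyticRank_of_analyticRank_le_one)
    (hMaz : mazur_not_dvd_maninConstant_of_odd) (hCassels : bsdRHS_eq_of_isIsogenous)
    (h2 : ∀ (W' : WeierstrassCurve ℚ) [W'.IsElliptic] [W'.IsGloballyMinimal],
      CellC W' p → BDPValueContinuousDisplayAt W' p)
    (h3n : ∀ (W' : WeierstrassCurve ℚ) [W'.IsElliptic] [W'.IsGloballyMinimal],
      CellC W' p → ¬ W'.HasSplitMultiplicativeReductionAtPrime p → NonsplitIMCEqOnTreeIntOther W' p)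
    (h3s : ∀ (W' : WeierstrassCurve ℚ) [W'.IsElliptic] [W'.IsGloballyMinimal],
      CellC W' p → W'.HasSplitMultiplicativeReductionAtPrime p → SplitIMCEqOnTreeIntOther W' p)
    (hc : CellC W p)
    (K : Type) [Field K] [NumberField K] (hK : IsImaginaryQuadratic K)
    (hodd : Odd (NumberField.discr K)) (hlt : NumberField.discr K < -4)
    (hHN : SatisfiesHeegnerHypothesis (W.conductorNorm ℤ) K) (hHp : SatisfiesHeegnerHypothesis p K)
    (hLK : (W.quadraticTwist (NumberField.discr K : ℚ)).entireLFunction 1 ≠ 0)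
    (Wd : WeierstrassCurve ℚ) [Wd.IsElliptic] [Wd.IsGloballyMinimal]
    (hWd : ∃ C : VariableChange ℚ, C • Wd = W.quadraticTwist (NumberField.discr K : ℚ))
    (hunit : ∃ q : ℚ, shaAn Wd = (q : ℂ) ∧ padicValRat p q = 0) : BSDp W p := by
  have hD0 : (NumberField.discr K : ℚ) ≠ 0 := by exact_mod_cast NumberField.discr_ne_zero K
  haveI hEt : (W.quadraticTwist (NumberField.discr K : ℚ)).IsElliptic := W.isElliptic_quadraticTwist hD0
  have hXd : ClassX2 Wd p := classX2_twist W p hc.2 K hK hHp Wd hWd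
  obtain ⟨Cd, hCd⟩ := hWd
  have hLd : Wd.entireLFunction 1 ≠ 0 := by
    rw [← entireLFunction_smul Wd Cd, hCd]; exact hLK
  have hbsd : BSDp Wd p :=
    bsdp_of_L_one_ne_zero_of_padicValRat_shaAn_eq_zero hW21 hGZK Wd p hXd.1 hLd
      (WeierstrassCurve.HasMultiplicativeReduction.not_hasAdditiveReduction (R := ℤ_[p]) hXd.2.2)
      (Or.inl hXd.2.1) hunit
  exact bsdp_of_cellC_of_twistPartnerBSDp W p hnf hPT hPT2 hH hGZ hKo hGZK hMaz hCassels h2 h3n h3s hc K hK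
    hodd hlt hHN hHp hLK Wd ⟨Cd, hCd⟩ hbsd

end Door

/-! ### §3 Census shape: v9's published bundle + Wuthrich Prop. 21 + `LZZRoadInputIoo` + Keller–Yin Thm. D -/

section Census

/-- **PER-PAIR TWIST-CERTIFICATE ROAD at the PRE tier, census shape:** from v9's `stub_publishedFacts` bundle
VERBATIM (`hPub`), Wuthrich 2014 Prop. 21 (`hW21`), the typed LZZ input `X2.LZZRoadInputIoo` (`hL` — implied by
the REFEREED Liu–Zhang–Zhang fact, k5-c4's glue) and Keller–Yin Thm. D BY NAME (`hD`): for every X2c pair `(W, p)`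
of EITHER ψ-parity, every admissible `K` and every globally minimal model `Wd` of `E^{(d_K)}` with
`p ∤ #Ш(Wd)_an`, `BSD(E,p)` holds. The value atom comes from `X2.bdpValueContinuousDisplayAt_of_lzzRoadInputIoo`
at EVERY odd `p` (LZZ has no `p ≥ 5`), the IMC atoms from `X2.forall_{nonsplit,split}IMCEqOnTreeIntOther_of_thmD_OPEN`.
Census reading (nothing booked here): on the ψ-ODD B11 rows this replaces crux 3 by a per-pair certificate at the
same tier as the ψ-even door («literal on KY Thm D alone» + CERT). A `conditional-result`.
[claim: KellerYin2024, status: under-review] [cite: KellerYin2024, Thm. D = Thm. 5.1.3 (arXiv:2402.12781v2 L306–L309)]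
[cite: LiuZhangZhang2018, Thm. 1.5.1 and Thm. 1.5.3 (Duke 167 pp. 748–749) (source of the input; nothing asserted)]
[cite: Wuthrich2014, Prop. 21 (p. 400)] [cite: Hsieh2014, Thm. 1 (arXiv:1112.1580 pp. 3–4)]
[cite: CastellaEtAl2021, Thm. 5.3.1] [cite: Mazur1978, Cor. 4.1] [cite: Miller2011LMS, Def. 1.1] -/
theorem bsdp_of_cellC_of_twistShaUnit_of_lzzRoadInputIoo_of_thmD_OPEN
    (hPub : (lambdaMu_multiplicative_of_gvPar ∧ thm16_charIdeal_dvd_multiplicative_of_reducible ∧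
      thm61_splitMultiplicative ∧ thm61_nonsplitMultiplicative ∧
      (∀ (W : WeierstrassCurve ℚ) [W.IsElliptic] [W.IsGloballyMinimal] (p : ℕ) [Fact p.Prime],
        greenberg_stevens (W := W) (p := p)) ∧
      exists_isNewformOf ∧
      (∀ (K : Type) [Field K] [NumberField K], poitouTate_selmerStructure_duality K) ∧
      (∀ (K : Type) [Field K] [NumberField K], poitouTate_sha_tateDual K) ∧
      hsieh2014_exists_anticyclotomicPAdicLFunction ∧
      (∀ (N : ℕ) [NeZero N] (W : WeierstrassCurve ℚ) (K : Type) [Field K] [NumberField K],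
        gross_zagier N W K) ∧
      (∀ (N : ℕ) [NeZero N] (W : WeierstrassCurve ℚ) (K : Type) [Field K] [NumberField K],
        kolyvagin N W K) ∧
      rank_eq_analyticRank_of_analyticRank_le_one ∧ HoffsteinLuo1997_exists_twist_L_one_ne_zero ∧
      mazur_not_dvd_maninConstant_of_odd ∧ bsdRHS_eq_of_isIsogenous) ∧
      thm210_thm211_bdpDisplay_pNew)
    (hW21 : sha_dvd_analyticSha) (hL : X2.LZZRoadInputIoo)
    (hD : KellerYin2024.thmD_imcMult_exists_isBDPLFunction_isTorsion_charIdeal_eq_OPEN)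
    (W : WeierstrassCurve ℚ) [W.IsElliptic] [W.IsGloballyMinimal] (p : ℕ) [Fact p.Prime] (hc : CellC W p)
    (K : Type) [Field K] [NumberField K] (hK : IsImaginaryQuadratic K)
    (hodd : Odd (NumberField.discr K)) (hlt : NumberField.discr K < -4)
    (hHN : SatisfiesHeegnerHypothesis (W.conductorNorm ℤ) K) (hHp : SatisfiesHeegnerHypothesis p K)
    (hLK : (W.quadraticTwist (NumberField.discr K : ℚ)).entireLFunction 1 ≠ 0)
    (Wd : WeierstrassCurve ℚ) [Wd.IsElliptic] [Wd.IsGloballyMinimal]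
    (hWd : ∃ C : VariableChange ℚ, C • Wd = W.quadraticTwist (NumberField.discr K : ℚ))
    (hunit : ∃ q : ℚ, shaAn Wd = (q : ℂ) ∧ padicValRat p q = 0) : BSDp W p := by
  obtain ⟨⟨-, -, -, -, -, hnf, hPT, hPT2, hH, hGZ, hKo, hGZK, -, hMaz, hCassels⟩, -⟩ := hPub
  exact bsdp_of_cellC_of_twistShaUnit W p hW21 hnf hPT hPT2 hH hGZ hKo hGZK hMaz hCassels
    (fun W' _ _ _ ↦ X2.bdpValueContinuousDisplayAt_of_lzzRoadInputIoo hL W' p)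
    (fun W' _ _ hc' hns ↦ X2.forall_nonsplitIMCEqOnTreeIntOther_of_thmD_OPEN hD W' p hc' hns)
    (fun W' _ _ hc' hs ↦ X2.forall_splitIMCEqOnTreeIntOther_of_thmD_OPEN hD W' p hc' hs)
    hc K hK hodd hlt hHN hHp hLK Wd hWd hunit

/-- **PER-PAIR TWIST-CERTIFICATE ROAD, FACT LEVEL:** as the previous theorem with the REFEREED Liu–Zhang–Zhang fact
(`hF`, Duke 167 Thm. 1.5.1 ∧ 1.5.3 at `p ‖ N`, typed p509230) in place of the typed input, through k5-c4's glue
`X2.lzzRoadInputIoo_of_thm151_thm153` (p515022). Binders: v9's published bundle + Wuthrich 2014 Prop. 21 + the LZZ fact +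
Keller–Yin Thm. D [PRE] + (pair, admissible `K`, minimal model of the twist with `p ∤ #Ш_an`). A `conditional-result`;
nothing booked. [claim: KellerYin2024, status: under-review]
[cite: KellerYin2024, Thm. D = Thm. 5.1.3 (arXiv:2402.12781v2 L306–L309)]
[cite: LiuZhangZhang2018, Thm. 1.5.1 and Remark 1.1.2 and Thm. 1.5.3 (Duke 167 pp. 745–749)]
[cite: Wuthrich2014, Prop. 21 (p. 400)] [cite: Hsieh2014, Thm. 1 (arXiv:1112.1580 pp. 3–4)]
[cite: CastellaEtAl2021, Thm. 5.3.1] [cite: Mazur1978, Cor. 4.1] [cite: Miller2011LMS, Def. 1.1] -/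
theorem bsdp_of_cellC_of_twistShaUnit_of_thm151_thm153_of_thmD_OPEN
    (hPub : (lambdaMu_multiplicative_of_gvPar ∧ thm16_charIdeal_dvd_multiplicative_of_reducible ∧
      thm61_splitMultiplicative ∧ thm61_nonsplitMultiplicative ∧
      (∀ (W : WeierstrassCurve ℚ) [W.IsElliptic] [W.IsGloballyMinimal] (p : ℕ) [Fact p.Prime],
        greenberg_stevens (W := W) (p := p)) ∧
      exists_isNewformOf ∧
      (∀ (K : Type) [Field K] [NumberField K], poitouTate_selmerStructure_duality K) ∧
      (∀ (K : Type) [Field K] [NumberField K], poitouTate_sha_tateDual K) ∧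
      hsieh2014_exists_anticyclotomicPAdicLFunction ∧
      (∀ (N : ℕ) [NeZero N] (W : WeierstrassCurve ℚ) (K : Type) [Field K] [NumberField K],
        gross_zagier N W K) ∧
      (∀ (N : ℕ) [NeZero N] (W : WeierstrassCurve ℚ) (K : Type) [Field K] [NumberField K],
        kolyvagin N W K) ∧
      rank_eq_analyticRank_of_analyticRank_le_one ∧ HoffsteinLuo1997_exists_twist_L_one_ne_zero ∧
      mazur_not_dvd_maninConstant_of_odd ∧ bsdRHS_eq_of_isIsogenous) ∧
      thm210_thm211_bdpDisplay_pNew)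
    (hW21 : sha_dvd_analyticSha) (hF : LiuZhangZhang2018.thm151_thm153_modularCurve_heegnerVector)
    (hD : KellerYin2024.thmD_imcMult_exists_isBDPLFunction_isTorsion_charIdeal_eq_OPEN)
    (W : WeierstrassCurve ℚ) [W.IsElliptic] [W.IsGloballyMinimal] (p : ℕ) [Fact p.Prime] (hc : CellC W p)
    (K : Type) [Field K] [NumberField K] (hK : IsImaginaryQuadratic K)
    (hodd : Odd (NumberField.discr K)) (hlt : NumberField.discr K < -4)
    (hHN : SatisfiesHeegnerHypothesis (W.conductorNorm ℤ) K) (hHp : SatisfiesHeegnerHypothesis p K)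
    (hLK : (W.quadraticTwist (NumberField.discr K : ℚ)).entireLFunction 1 ≠ 0)
    (Wd : WeierstrassCurve ℚ) [Wd.IsElliptic] [Wd.IsGloballyMinimal]
    (hWd : ∃ C : VariableChange ℚ, C • Wd = W.quadraticTwist (NumberField.discr K : ℚ))
    (hunit : ∃ q : ℚ, shaAn Wd = (q : ℂ) ∧ padicValRat p q = 0) : BSDp W p :=
  bsdp_of_cellC_of_twistShaUnit_of_lzzRoadInputIoo_of_thmD_OPEN hPub hW21
    (X2.lzzRoadInputIoo_of_thm151_thm153 hF) hD W p hc K hK hodd hlt hHN hHp hLK Wd hWd hunit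

end Census

/-! ### §4 The certificate read on a curve ISOGENOUS to the twist (Cassels) -/

section IsogenousCertificate
variable (W : WeierstrassCurve ℚ) [W.IsElliptic] [W.IsGloballyMinimal] (p : ℕ) [Fact p.Prime]

/-- **TWIST-CERTIFICATE DOOR with the certificate on ANY curve `Wc` `ℚ`-isogenous to the twist** (the `model=iso`
census rows, e.g. 439698ce @3, `d_K = −167`: `#Ш_an` is `36` on the twist, `4` on an isogenous curve): `Wc` is X2 at `p`
(`not_hasIrreducibleModPGaloisRep_of_isIsogenous`, `hasMultiplicativeReductionAt_of_isIsogenous`), `L(Wc,1) = L(Wd,1) ≠ 0`,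
so Wuthrich Prop. 21 gives `BSDp Wc p`, Cassels (`X2.bsdp_of_isIsogenous_of_bsdp`) moves it to `Wd`, then §1. Nothing booked.
[cite: Wuthrich2014, Prop. 21 (p. 400)] [cite: MilneADT2006, Thm. I.7.3] [claim: KellerYin2024, status: under-review] [cite: Miller2011LMS, Def. 1.1] -/
theorem bsdp_of_cellC_of_isogenousTwistShaUnit (hW21 : sha_dvd_analyticSha)
    (hnf : exists_isNewformOf)
    (hPT : ∀ (K : Type) [Field K] [NumberField K], poitouTate_selmerStructure_duality K)
    (hPT2 : ∀ (K : Type) [Field K] [NumberField K], poitouTate_sha_tateDual K)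
    (hH : hsieh2014_exists_anticyclotomicPAdicLFunction)
    (hGZ : ∀ (N : ℕ) [NeZero N] (W : WeierstrassCurve ℚ) (K : Type) [Field K] [NumberField K],
      gross_zagier N W K)
    (hKo : ∀ (N : ℕ) [NeZero N] (W : WeierstrassCurve ℚ) (K : Type) [Field K] [NumberField K],
      kolyvagin N W K)
    (hGZK : rank_eq_analyticRank_of_analyticRank_le_one)
    (hMaz : mazur_not_dvd_maninConstant_of_odd) (hCassels : bsdRHS_eq_of_isIsogenous)
    (h2 : ∀ (W' : WeierstrassCurve ℚ) [W'.IsElliptic] [W'.IsGloballyMinimal],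
      CellC W' p → BDPValueContinuousDisplayAt W' p)
    (h3n : ∀ (W' : WeierstrassCurve ℚ) [W'.IsElliptic] [W'.IsGloballyMinimal],
      CellC W' p → ¬ W'.HasSplitMultiplicativeReductionAtPrime p → NonsplitIMCEqOnTreeIntOther W' p)
    (h3s : ∀ (W' : WeierstrassCurve ℚ) [W'.IsElliptic] [W'.IsGloballyMinimal],
      CellC W' p → W'.HasSplitMultiplicativeReductionAtPrime p → SplitIMCEqOnTreeIntOther W' p)
    (hc : CellC W p)
    (K : Type) [Field K] [NumberField K] (hK : IsImaginaryQuadratic K)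
    (hodd : Odd (NumberField.discr K)) (hlt : NumberField.discr K < -4)
    (hHN : SatisfiesHeegnerHypothesis (W.conductorNorm ℤ) K) (hHp : SatisfiesHeegnerHypothesis p K)
    (hLK : (W.quadraticTwist (NumberField.discr K : ℚ)).entireLFunction 1 ≠ 0)
    (Wd : WeierstrassCurve ℚ) [Wd.IsElliptic] [Wd.IsGloballyMinimal]
    (hWd : ∃ C : VariableChange ℚ, C • Wd = W.quadraticTwist (NumberField.discr K : ℚ))
    (Wc : WeierstrassCurve ℚ) [Wc.IsElliptic] [Wc.IsGloballyMinimal] (hiso : IsIsogenous Wd Wc)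
    (hunit : ∃ q : ℚ, shaAn Wc = (q : ℂ) ∧ padicValRat p q = 0) : BSDp W p := by
  have hp : p.Prime := Fact.out
  have hmod : hasEntireLFunction_rat := WeierstrassCurve.hasEntireLFunction_rat_of_exists_isNewformOf hnf
  have hD0 : (NumberField.discr K : ℚ) ≠ 0 := by exact_mod_cast NumberField.discr_ne_zero K
  haveI hEt : (W.quadraticTwist (NumberField.discr K : ℚ)).IsElliptic := W.isElliptic_quadraticTwist hD0
  have hXd : ClassX2 Wd p := classX2_twist W p hc.2 K hK hHp Wd hWd
  obtain ⟨Cd, hCd⟩ := hWd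
  have hLd : Wd.entireLFunction 1 ≠ 0 := by
    rw [← entireLFunction_smul Wd Cd, hCd]; exact hLK
  -- `Wc` is X2 at `p` with `L(Wc,1) ≠ 0`
  have hLc : Wc.entireLFunction 1 ≠ 0 := by
    rw [← entireLFunction_eq_of_isIsogenous' hiso]; exact hLd
  have hredc : ¬ Wc.HasIrreducibleModPGaloisRep p := not_hasIrreducibleModPGaloisRep_of_isIsogenous hiso hXd.2.1
  have hmultc : Wc.HasMultiplicativeReductionAtPrime p := by
    have hb := WeierstrassCurve.hasMultiplicativeReductionAtPrime_iff_hasMultiplicativeReductionAt_holds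
    have h1 : Wd.HasMultiplicativeReductionAt
        ((Rat.HeightOneSpectrum.primesEquiv (R := ℤ)).symm ⟨p, hp⟩) := (hb Wd ⟨p, hp⟩).mp hXd.2.2
    exact (hb Wc ⟨p, hp⟩).mpr (hasMultiplicativeReductionAt_of_isIsogenous hiso _ h1)
  have hbsdc : BSDp Wc p :=
    bsdp_of_L_one_ne_zero_of_padicValRat_shaAn_eq_zero hW21 hGZK Wc p hXd.1 hLc
      (WeierstrassCurve.HasMultiplicativeReduction.not_hasAdditiveReduction (R := ℤ_[p]) hmultc)
      (Or.inl hredc) hunit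
  -- Cassels back to the model of the twist, then §1
  have hrc : Wc.analyticRank = 0 := (Wc.analyticRank_eq_zero_iff_holds (hmod _)).2 hLc
  have hbsd : BSDp Wd p :=
    bsdp_of_isIsogenous_of_bsdp hCassels hGZK hmod Wc Wd hiso.symm_of_charZero p
      (by rw [hrc]; exact zero_le_one) hbsdc
  exact bsdp_of_cellC_of_twistPartnerBSDp W p hnf hPT hPT2 hH hGZ hKo hGZK hMaz hCassels h2 h3n h3s hc K hK
    hodd hlt hHN hHp hLK Wd ⟨Cd, hCd⟩ hbsd
end IsogenousCertificate

end Summit.BirchSwinnertonDyer.BirchSwinnertonDyer.Theorems.Reoriented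

end
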